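/-
Copyright (c) 2026. All rights reserved.
Released under Apache 2.0 license as described in the file LICENSE.
-/
import Literature.Geometry.Kaehler.ComplexTorusQuaternionXSixEichlerClassNumberFormula
import Literature.Geometry.Kaehler.ComplexTorusQuaternionXSixSpecialCyclesDegreeClosedForm
import HarnessLib

/-!
# Kudla–Rapoport–Yang's degree formula for the special cycles of `X₆`, for EVERY `t > 0`:
# `deg Z(t)_ℚ = 2·δ(d; 6)·H₀(t; 6)`, `δ(d; 6) = (1 − χ_d(2))(1 − χ_d(3))`, `H₀(t; 6) = Σ_{c ∣ n, (c,6)=1} h(c²d)/w(c²d)`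

Seventh (last) file of the Eichler-count plan for the X₆ special cycles. The series proved KRY's identity
(3.4.14) = (3.4.4)·(3.4.6), `2·Σᶠ_{[x] ∈ L(t)/O₆^×} e_x⁻¹ = 2·δ(d; 6)·Σ_{c ∣ n, (c,6)=1} h(−c²d)/w(−c²d)` (`4t = n²d`), for
eighteen values of `t` (`…XSixSpecialCyclesDegree`, `…DegreeValues`) and, for every `t`, the closed form
`deg Z(t)_ℚ = |L(t)/O₆^×| − [t = m²] − (4/3)·[t = 3m²]` (`…XSixSpecialCyclesDegreeClosedForm`, «`|L(t)/O₆^×|` NOT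
evaluated in general»). `…XSixEichlerClassNumberFormula` evaluated `|L(t)/O₆^×| = δ·Σ_{c ∣ F, (c,6)=1} h(c²·d_K)`
(`F = Brandt.conductor 0 t` = KRY's `n`, `d_K = t_F² − 4n_F = −d`). This file combines the two into KRY's degree formula
for ALL `t > 0`:

* §1 the fundamental discriminant `d_K`: `d_K ≡ 0, 1 (mod 4)`, `d_K ≤ −3`; `d_K = −4 ⟺ t` is a square (`F = √t`),
  `d_K = −3 ⟺ t = 3k²` (`F = 2k`) — the two elliptic cases (`conductor_of_sq`, `conductor_of_three_mul_sq`,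
  `isSquare_of_disc_conductor_eq`, `exists_eq_three_mul_sq_of_disc_conductor_eq`).
* §2 `sum_classNumber_div_unitsOfDisc`: `Σ_{c ∣ F, (c,6)=1} h(c²d_K)/w(c²d_K) = ½·Σ h(c²d_K) − ¼·[d_K = −4] − ⅓·[d_K = −3]`
  (`w = 2` except `w(−4) = 4`, `w(−3) = 6`, only at `c = 1`; `h(−3) = h(−4) = 1`).
* §3 **`kry_degree_formula`**: for every `t > 0`,
  `2·Σᶠ_{[x] ∈ L(t)/O₆^×} e_x⁻¹ = 2·(1 − χ₈(d_K))·(1 − (d_K∕3)) · Σ_{c ∣ F, (c,6)=1} h(c²·d_K) / w(c²·d_K)`,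
  `w = Brandt.unitsOfDisc` (`= |O_{c²d}^×|`: `4, 6, 2`) — KRY (3.4.4)–(3.4.6) = (3.4.14) on `X₆` in general.

## Sources

* [KRY] S. Kudla, M. Rapoport, T. Yang, *Modular Forms and Special Cycles on Shimura Curves*, Ann. of Math. Stud. 161
  (2006), §3.4 (3.4.4)–(3.4.6) («`deg Z(t) = 2δ(d;D(B))H₀(t;D(B))`», «`w(c²d)` is the number of units in `O_{c²d}`»),
  (3.4.13)–(3.4.14). [cite: KudlaRapoportYang2006, §3.4 (3.4.4)–(3.4.6), (3.4.13)–(3.4.14)]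
* M. Eichler (1955), Satz 5; M.-F. Vignéras, LNM 800 (1980), Ch. III §5 Cor. 5.12–5.14. [cite: Eichler1955, Satz 5] [cite: VignerasLNM800, Ch. III §5 Cor. 5.12–5.14]
* D. A. Cox, *Primes of the form x² + ny²*, 2nd ed. (2013), §7.A (7.2)–(7.3). [cite: Cox2013, §7.A]

## Scope (honest)

Theorems only — no definition, no named fact, no instance. `n`, `d` of KRY are the tree's `conductor 0 t` and
`−(t_F² − 4n_F)`; that `−d_K` is the discriminant of Mathlib's `𝓞 ℚ(√−t)` is not restated here.
-/

set_option maxSynthPendingDepth 3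

open Quaternion Function
open scoped Pointwise
open Literature.NumberTheory.Automorphic Literature.NumberTheory.Automorphic.Brandt
open Literature.NumberTheory.Automorphic.HeckeTraceFormulaGL2Level (ellipticConductors)
open Literature.NumberTheory.QuadraticFields.Quadratic (BinQF.classNumber)

namespace Literature.Geometry.Kaehler.ComplexTorus.QuaternionType

/-! ## §1 The fundamental discriminant `d_K = t_F² − 4n_F` and the two elliptic cases -/

section Disc

/-- `d_K ≡ 0` or `1 (mod 4)`. [cite: Cox2013, §7.A (7.2)] -/
theorem disc_conductor_emod_four {m : ℕ} (hm : 0 < m) : (tOf 0 m (conductor 0 m) ^ 2 - 4 * nOf 0 m (conductor 0 m)) % 4 = 0 ∨ (tOf 0 m (conductor 0 m) ^ 2 - 4 * nOf 0 m (conductor 0 m)) % 4 = 1 := by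
  have h0 : (0 : ℤ) ^ 2 < 4 * m := by positivity
  rw [← disc_div_sq h0 (conductor_mem h0)]
  exact ((mem_ellipticConductors_iff h0).mp (conductor_mem h0)).2.2

/-- `d_K < 0` (indeed `d_K ≤ −3`: a negative discriminant `≡ 0, 1 (mod 4)`). [cite: Cox2013, §7.A (7.2) and Thm. 7.7 (negative discriminants of orders)] -/
theorem disc_conductor_le {m : ℕ} (hm : 0 < m) : (tOf 0 m (conductor 0 m) ^ 2 - 4 * nOf 0 m (conductor 0 m)) ≤ -3 := by
  have h := conductor_sq_mul_disc hm
  have hF : (0 : ℤ) < (conductor 0 m : ℕ) := by exact_mod_cast conductor_pos (show (0 : ℤ) ^ 2 < 4 * m by positivity)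
  have hneg : (tOf 0 m (conductor 0 m) ^ 2 - 4 * nOf 0 m (conductor 0 m)) < 0 := by
    by_contra hge
    rw [not_lt] at hge
    have : (0 : ℤ) ≤ ((conductor 0 m : ℕ) : ℤ) ^ 2 * (tOf 0 m (conductor 0 m) ^ 2 - 4 * nOf 0 m (conductor 0 m)) := mul_nonneg (sq_nonneg _) hge
    rw [h] at this
    have : (0 : ℤ) < m := by exact_mod_cast hm
    omega
  have h4 := disc_conductor_emod_four hm
  omega

/-- `d_K = −4 ⟹ t = F²` is a square. [cite: KudlaRapoportYang2006, §3.4 (3.4.6) («`w(−4) = 4`»)] -/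
theorem isSquare_of_disc_conductor_eq {m : ℕ} (hm : 0 < m) (h : (tOf 0 m (conductor 0 m) ^ 2 - 4 * nOf 0 m (conductor 0 m)) = -4) : IsSquare (m : ℤ) := by
  have e := conductor_sq_mul_disc hm
  rw [h] at e
  exact ⟨(conductor 0 m : ℕ), by nlinarith⟩

/-- `d_K = −3 ⟹ t = 3k²` (`F = 2k`). [cite: KudlaRapoportYang2006, §3.4 (3.4.6) («`w(−3) = 6`»)] -/
theorem exists_eq_three_mul_sq_of_disc_conductor_eq {m : ℕ} (hm : 0 < m) (h : (tOf 0 m (conductor 0 m) ^ 2 - 4 * nOf 0 m (conductor 0 m)) = -3) :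
    ∃ k : ℤ, (m : ℤ) = 3 * k ^ 2 := by
  have e := conductor_sq_mul_disc hm
  rw [h] at e
  -- `3F² = 4m` forces `F` even
  rcases Int.even_or_odd ((conductor 0 m : ℕ) : ℤ) with ⟨j, hj⟩ | ⟨j, hj⟩
  · refine ⟨j, ?_⟩
    rw [hj] at e
    nlinarith
  · exfalso
    rw [hj] at e
    have : (2 * j + 1) ^ 2 * (-3 : ℤ) = -(12 * (j * j) + 12 * j + 3) := by ring
    rw [this] at e
    omega

/-- The conductor set of `(0, k²)` contains `k`: `ℤ[ki] ⊂ ℤ[i]` has index `k`. [cite: Cox2013, §7.A (7.2)–(7.3)] -/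
private theorem mem_ellipticConductors_sq₆₇ {k : ℕ} (hk : 0 < k) : k ∈ ellipticConductors 0 (k ^ 2) := by
  have h0 : (0 : ℤ) ^ 2 < 4 * ((k ^ 2 : ℕ) : ℤ) := by positivity
  rw [mem_ellipticConductors_iff h0]
  have hk2 : ((k : ℤ)) ^ 2 ≠ 0 := by positivity
  have e : (0 : ℤ) ^ 2 - 4 * ((k ^ 2 : ℕ) : ℤ) = (k : ℤ) ^ 2 * (-4) := by push_cast; ring
  refine ⟨hk, ⟨-4, e⟩, ?_⟩
  rw [e, Int.mul_ediv_cancel_left _ hk2]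
  decide

/-- The conductor set of `(0, 3k²)` contains `2k`: `ℤ[k√−3] ⊂ ℤ[ζ₃]` has index `2k`. [cite: Cox2013, §7.A (7.2)–(7.3)] -/
private theorem mem_ellipticConductors_three_mul_sq₆₇ {k : ℕ} (hk : 0 < k) : 2 * k ∈ ellipticConductors 0 (3 * k ^ 2) := by
  have h0 : (0 : ℤ) ^ 2 < 4 * ((3 * k ^ 2 : ℕ) : ℤ) := by positivity
  rw [mem_ellipticConductors_iff h0]
  have hk2 : (((2 * k : ℕ) : ℤ)) ^ 2 ≠ 0 := by positivity
  have e : (0 : ℤ) ^ 2 - 4 * ((3 * k ^ 2 : ℕ) : ℤ) = (((2 * k : ℕ) : ℤ)) ^ 2 * (-3) := by push_cast; ring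
  refine ⟨by omega, ⟨-3, e⟩, ?_⟩
  rw [e, Int.mul_ediv_cancel_left _ hk2]
  decide

/-- **`t = k²`: `F = k` and `d_K = −4`** (`ℚ(√−t) = ℚ(i)`). [cite: Cox2013, §7.A (7.3)] [cite: KudlaRapoportYang2006, §3.4 (table: `4t = n²·4`)] -/
theorem conductor_of_sq {k : ℕ} (hk : 0 < k) :
    conductor 0 (k ^ 2) = k ∧ tOf 0 (k ^ 2) (conductor 0 (k ^ 2)) ^ 2 - 4 * nOf 0 (k ^ 2) (conductor 0 (k ^ 2)) = -4 := by
  have h0 : (0 : ℤ) ^ 2 < 4 * ((k ^ 2 : ℕ) : ℤ) := by positivity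
  have hF := (mem_ellipticConductors_iff h0).mp (conductor_mem h0)
  obtain ⟨a, ha⟩ : k ∣ conductor 0 (k ^ 2) := dvd_conductor (mem_ellipticConductors_sq₆₇ hk)
  obtain ⟨hF0, ⟨d, hd⟩, hmod⟩ := hF
  rw [ha] at hd hmod
  have hk2 : ((k : ℤ)) ^ 2 ≠ 0 := by positivity
  have ha0 : 0 < a := Nat.pos_of_ne_zero fun h => by rw [ha, h, mul_zero] at hF0; exact lt_irrefl 0 hF0
  -- `a² d = -4`, so `a ∣ 2`
  have had : (a : ℤ) ^ 2 * d = -4 := by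
    apply mul_left_cancel₀ hk2
    have : (0 : ℤ) ^ 2 - 4 * ((k ^ 2 : ℕ) : ℤ) = (k : ℤ) ^ 2 * (-4) := by push_cast; ring
    rw [← this, hd]; push_cast; ring
  have ha2 : a ≤ 2 := by
    by_contra hlt
    rw [not_le] at hlt
    have h9 : (9 : ℤ) ≤ (a : ℤ) ^ 2 := by nlinarith
    have hd0 : d < 0 := by nlinarith
    nlinarith
  have hquot : ((0 : ℤ) ^ 2 - 4 * ((k ^ 2 : ℕ) : ℤ)) / (((k * a : ℕ) : ℤ)) ^ 2 = d := by
    rw [hd, Int.mul_ediv_cancel_left _ (by positivity)]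
  rw [hquot] at hmod
  interval_cases a
  · -- `a = 1`
    rw [mul_one] at ha
    refine ⟨ha, ?_⟩
    rw [← disc_div_sq h0 (conductor_mem h0), ha]
    have : (0 : ℤ) ^ 2 - 4 * ((k ^ 2 : ℕ) : ℤ) = (k : ℤ) ^ 2 * (-4) := by push_cast; ring
    rw [this, Int.mul_ediv_cancel_left _ hk2]
  · -- `a = 2`: `d = -1`, not a discriminant
    exfalso
    have : d = -1 := by push_cast at had; omega
    omega

/-- **`t = 3k²`: `F = 2k` and `d_K = −3`** (`ℚ(√−t) = ℚ(√−3)`). [cite: Cox2013, §7.A (7.3)] [cite: KudlaRapoportYang2006, §3.4 (table: `4t = n²·3`)] -/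
theorem conductor_of_three_mul_sq {k : ℕ} (hk : 0 < k) :
    conductor 0 (3 * k ^ 2) = 2 * k ∧
      tOf 0 (3 * k ^ 2) (conductor 0 (3 * k ^ 2)) ^ 2 - 4 * nOf 0 (3 * k ^ 2) (conductor 0 (3 * k ^ 2)) = -3 := by
  have h0 : (0 : ℤ) ^ 2 < 4 * ((3 * k ^ 2 : ℕ) : ℤ) := by positivity
  have hF := (mem_ellipticConductors_iff h0).mp (conductor_mem h0)
  obtain ⟨a, ha⟩ : 2 * k ∣ conductor 0 (3 * k ^ 2) := dvd_conductor (mem_ellipticConductors_three_mul_sq₆₇ hk)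
  obtain ⟨hF0, ⟨d, hd⟩, hmod⟩ := hF
  rw [ha] at hd hmod
  have hk2 : (((2 * k : ℕ) : ℤ)) ^ 2 ≠ 0 := by positivity
  have ha0 : 0 < a := Nat.pos_of_ne_zero fun h => by rw [ha, h, mul_zero] at hF0; exact lt_irrefl 0 hF0
  have had : (a : ℤ) ^ 2 * d = -3 := by
    apply mul_left_cancel₀ hk2
    have : (0 : ℤ) ^ 2 - 4 * ((3 * k ^ 2 : ℕ) : ℤ) = (((2 * k : ℕ) : ℤ)) ^ 2 * (-3) := by push_cast; ring
    rw [← this, hd]; push_cast; ring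
  have ha1 : a ≤ 1 := by
    by_contra hlt
    rw [not_le] at hlt
    have h4 : (4 : ℤ) ≤ (a : ℤ) ^ 2 := by nlinarith
    have hd0 : d < 0 := by nlinarith
    nlinarith
  interval_cases a
  rw [mul_one] at ha
  refine ⟨ha, ?_⟩
  rw [← disc_div_sq h0 (conductor_mem h0), ha]
  have : (0 : ℤ) ^ 2 - 4 * ((3 * k ^ 2 : ℕ) : ℤ) = (((2 * k : ℕ) : ℤ)) ^ 2 * (-3) := by push_cast; ring
  rw [this, Int.mul_ediv_cancel_left _ hk2]

end Disc

/-! ## §2 `H₀`: the sum `Σ_{c ∣ F, (c,6)=1} h(c²d_K)/w(c²d_K)` -/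

section H0

/-- `1` is an admissible index. [folklore] -/
private theorem one_mem₆₇ {m : ℕ} (hm : 0 < m) : 1 ∈ ((conductor 0 m).divisors.filter fun c : ℕ => c.Coprime 6) := by
  rw [Finset.mem_filter, Nat.mem_divisors]
  exact ⟨⟨one_dvd _, (conductor_pos (show (0 : ℤ) ^ 2 < 4 * m by positivity)).ne'⟩, Nat.coprime_one_left 6⟩

/-- For `c ≥ 2`, `w(c²d_K) = 2`. [cite: KudlaRapoportYang2006, §3.4 (3.4.6)] -/
private theorem unitsOfDisc_eq_two₆₇ {m : ℕ} (hm : 0 < m) {c : ℕ} (hc : 2 ≤ c) :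
    unitsOfDisc (((c : ℕ) : ℤ) ^ 2 * (tOf 0 m (conductor 0 m) ^ 2 - 4 * nOf 0 m (conductor 0 m))) = 2 := by
  have hD := disc_conductor_le hm
  have hc2 : (4 : ℤ) ≤ ((c : ℕ) : ℤ) ^ 2 := by
    have : (2 : ℤ) ≤ c := by exact_mod_cast hc
    nlinarith
  have hlt : ((c : ℕ) : ℤ) ^ 2 * (tOf 0 m (conductor 0 m) ^ 2 - 4 * nOf 0 m (conductor 0 m)) ≤ -12 := by nlinarith
  unfold unitsOfDisc
  rw [if_neg (by omega), if_neg (by omega)]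

/-- **`Σ_{c ∣ F, (c,6)=1} h(c²d_K)/w(c²d_K) = ½·Σ_{c} h(c²d_K) − ¼·[d_K = −4] − ⅓·[d_K = −3]`**: only the term `c = 1`
can have `w ≠ 2`, namely `w(−4) = 4` (`h(−4) = 1`) or `w(−3) = 6` (`h(−3) = 1`). [cite: KudlaRapoportYang2006, §3.4 (3.4.6)] -/
theorem sum_classNumber_div_unitsOfDisc {m : ℕ} (hm : 0 < m) :
    ∑ c ∈ ((conductor 0 m).divisors.filter fun c : ℕ => c.Coprime 6), (BinQF.classNumber (((c : ℕ) : ℤ) ^ 2 * (tOf 0 m (conductor 0 m) ^ 2 - 4 * nOf 0 m (conductor 0 m))) : ℚ) / unitsOfDisc (((c : ℕ) : ℤ) ^ 2 * (tOf 0 m (conductor 0 m) ^ 2 - 4 * nOf 0 m (conductor 0 m))) =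
      (∑ c ∈ ((conductor 0 m).divisors.filter fun c : ℕ => c.Coprime 6), (BinQF.classNumber (((c : ℕ) : ℤ) ^ 2 * (tOf 0 m (conductor 0 m) ^ 2 - 4 * nOf 0 m (conductor 0 m))) : ℚ)) / 2 -
        (if (tOf 0 m (conductor 0 m) ^ 2 - 4 * nOf 0 m (conductor 0 m)) = -4 then 1 / 4 else 0) - (if (tOf 0 m (conductor 0 m) ^ 2 - 4 * nOf 0 m (conductor 0 m)) = -3 then 1 / 3 else 0) := by
  rw [← Finset.add_sum_erase _ _ (one_mem₆₇ hm), ← Finset.add_sum_erase _ _ (one_mem₆₇ hm)]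
  have hrest : ∀ c ∈ (((conductor 0 m).divisors.filter fun c : ℕ => c.Coprime 6)).erase 1,
      (BinQF.classNumber (((c : ℕ) : ℤ) ^ 2 * (tOf 0 m (conductor 0 m) ^ 2 - 4 * nOf 0 m (conductor 0 m))) : ℚ) / unitsOfDisc (((c : ℕ) : ℤ) ^ 2 * (tOf 0 m (conductor 0 m) ^ 2 - 4 * nOf 0 m (conductor 0 m))) =
        (BinQF.classNumber (((c : ℕ) : ℤ) ^ 2 * (tOf 0 m (conductor 0 m) ^ 2 - 4 * nOf 0 m (conductor 0 m))) : ℚ) / 2 := by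
    intro c hc
    rw [Finset.mem_erase, Finset.mem_filter, Nat.mem_divisors] at hc
    have hc2 : 2 ≤ c := by
      rcases Nat.eq_zero_or_pos c with h | h
      · exact absurd hc.2.1.1 (by rw [h]; simp [hc.2.1.2])
      · omega
    rw [unitsOfDisc_eq_two₆₇ hm hc2, Nat.cast_two]
  rw [Finset.sum_congr rfl hrest, ← Finset.sum_div, add_div]
  simp only [Nat.cast_one, one_pow, one_mul]
  have hD := disc_conductor_le hm
  unfold unitsOfDisc
  by_cases h3 : (tOf 0 m (conductor 0 m) ^ 2 - 4 * nOf 0 m (conductor 0 m)) = -3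
  · rw [if_pos h3, if_neg (by omega), if_pos h3, h3]
    rw [show BinQF.classNumber (-3) = 1 by decide]
    push_cast; ring
  · by_cases h4 : (tOf 0 m (conductor 0 m) ^ 2 - 4 * nOf 0 m (conductor 0 m)) = -4
    · rw [if_neg h3, if_pos h4, if_pos h4, if_neg h3, h4]
      rw [show BinQF.classNumber (-4) = 1 by decide]
      push_cast; ring
    · rw [if_neg h3, if_neg h4, if_neg h4, if_neg h3]
      push_cast; ring

end H0

/-! ## §3 KRY's degree formula on `X₆`, all `t` -/

section KRY

/-- **KUDLA–RAPOPORT–YANG'S DEGREE FORMULA FOR `X₆`, for EVERY `t > 0`**: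
`deg Z(t)_ℚ = 2·Σᶠ_{[x] ∈ L(t)/O₆^×} e_x⁻¹ = 2·δ(d; 6)·H₀(t; 6)` with `δ(d; 6) = (1 − χ_d(2))(1 − χ_d(3))`
(`= (1 − χ₈(d_K))(1 − (d_K∕3))`) and `H₀(t; 6) = Σ_{c ∣ n, (c, 6) = 1} h(c²d)/w(c²d)` (`n = F = conductor 0 t`,
`−d = d_K = t_F² − 4n_F`, `w = |O_{c²d}^×| = Brandt.unitsOfDisc`): (3.4.4)–(3.4.6) = (3.4.14) of [KRY] on the Shimura
curve of discriminant `6`, in general — the eighteen tabulated rows of `…XSixSpecialCyclesDegree(Values)` are instances.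
Assembly: `deg = |L(t)/O₆^×| − [t = k²] − (4/3)[t = 3k²]` (`…DegreeClosedForm`), `|L(t)/O₆^×| = δ·Σ h(c²d_K)`
(`…EichlerClassNumberFormula`), and §1–§2. [cite: KudlaRapoportYang2006, §3.4 (3.4.4)–(3.4.6) and (3.4.13)–(3.4.14)] [cite: Eichler1955, Satz 5] [cite: VignerasLNM800, Ch. III §5 Cor. 5.12–5.14] -/
theorem kry_degree_formula {m : ℕ} (hm : 0 < m) :
    2 * ∑ᶠ q : (Quot (fun x y : {x : ℤ × ℤ × ℤ // x.1 ^ 2 - 3 * x.2.1 ^ 2 - 3 * x.2.2 ^ 2 = (m : ℤ)} ↦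
      ∃ v : ℍ[ℚ,((-1 : ℤ) : ℚ),((3 : ℤ) : ℚ)], (v ∈ order (-1) 3 ∨ v - ⟨1/2, 1/2, 1/2, -1/2⟩ ∈ order (-1) 3) ∧
        ((v * star v).re = 1 ∨ (v * star v).re = -1) ∧
        v * ⟨0, x.1.1, x.1.2.1, x.1.2.2⟩ = ⟨0, y.1.1, y.1.2.1, y.1.2.2⟩ * v)),
        ((Nat.card
          {u : ℍ[ℚ,((-1 : ℤ) : ℚ),((3 : ℤ) : ℚ)] // (u ∈ order (-1) 3 ∨ u - ⟨1/2, 1/2, 1/2, -1/2⟩ ∈ order (-1) 3) ∧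
            ((u * star u).re = 1 ∨ (u * star u).re = -1) ∧
            u * ⟨0, q.out.1.1, q.out.1.2.1, q.out.1.2.2⟩ = ⟨0, q.out.1.1, q.out.1.2.1, q.out.1.2.2⟩ * u} : ℚ))⁻¹ =
      2 * (((1 - ZMod.χ₈ ((((tOf 0 m (conductor 0 m) ^ 2 - 4 * nOf 0 m (conductor 0 m)) : ℤ)) : ZMod 8)) * (1 - legendreSym 3 (tOf 0 m (conductor 0 m) ^ 2 - 4 * nOf 0 m (conductor 0 m))) : ℤ) : ℚ) *
        ∑ c ∈ ((conductor 0 m).divisors.filter fun c : ℕ => c.Coprime 6), (BinQF.classNumber (((c : ℕ) : ℤ) ^ 2 * (tOf 0 m (conductor 0 m) ^ 2 - 4 * nOf 0 m (conductor 0 m))) : ℚ) / unitsOfDisc (((c : ℕ) : ℤ) ^ 2 * (tOf 0 m (conductor 0 m) ^ 2 - 4 * nOf 0 m (conductor 0 m))) := by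
  have ht : (0 : ℤ) < (m : ℤ) := by exact_mod_cast hm
  have hL : (Nat.card (Quot (fun x y : {x : ℤ × ℤ × ℤ // x.1 ^ 2 - 3 * x.2.1 ^ 2 - 3 * x.2.2 ^ 2 = (m : ℤ)} ↦
      ∃ v : ℍ[ℚ,((-1 : ℤ) : ℚ),((3 : ℤ) : ℚ)], (v ∈ order (-1) 3 ∨ v - ⟨1/2, 1/2, 1/2, -1/2⟩ ∈ order (-1) 3) ∧
        ((v * star v).re = 1 ∨ (v * star v).re = -1) ∧
        v * ⟨0, x.1.1, x.1.2.1, x.1.2.2⟩ = ⟨0, y.1.1, y.1.2.1, y.1.2.2⟩ * v)) : ℚ) =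
      (((1 - ZMod.χ₈ ((((tOf 0 m (conductor 0 m) ^ 2 - 4 * nOf 0 m (conductor 0 m)) : ℤ)) : ZMod 8)) * (1 - legendreSym 3 (tOf 0 m (conductor 0 m) ^ 2 - 4 * nOf 0 m (conductor 0 m))) : ℤ) : ℚ) *
        ∑ c ∈ ((conductor 0 m).divisors.filter fun c : ℕ => c.Coprime 6), (BinQF.classNumber (((c : ℕ) : ℤ) ^ 2 * (tOf 0 m (conductor 0 m) ^ 2 - 4 * nOf 0 m (conductor 0 m))) : ℚ) := by
    exact_mod_cast card_unit_classes_eq_kronecker_mul_sum_classNumber hm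
  rw [sum_classNumber_div_unitsOfDisc hm]
  by_cases h1 : IsSquare (m : ℤ)
  · -- `t = k²`: `d_K = -4`, `δ = 2`, correction `-1`
    obtain ⟨r, hr⟩ := h1
    obtain ⟨k, hk⟩ : ∃ k : ℕ, m = k ^ 2 := ⟨r.natAbs, by
      have : ((r.natAbs ^ 2 : ℕ) : ℤ) = (m : ℤ) := by rw [Nat.cast_pow, Int.natAbs_sq, hr, sq]
      exact_mod_cast this.symm⟩
    have hk0 : 0 < k := Nat.pos_of_ne_zero fun h => by rw [h] at hk; simp at hk; omega
    rw [degree_eq_card_sub_one_of_sq ht ⟨r, hr⟩, hL]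
    subst hk
    rw [(conductor_of_sq hk0).2]
    have hδ : (((1 - ZMod.χ₈ (((-4 : ℤ)) : ZMod 8)) * (1 - legendreSym 3 (-4)) : ℤ) : ℚ) = 2 := by
      have : (1 - ZMod.χ₈ (((-4 : ℤ)) : ZMod 8)) * (1 - legendreSym 3 (-4)) = 2 := by decide +kernel
      rw [this]; norm_num
    rw [hδ, if_pos rfl, if_neg (by norm_num)]
    ring
  · by_cases h3 : ∃ k : ℤ, (m : ℤ) = 3 * k ^ 2
    · -- `t = 3k²`: `d_K = -3`, `δ = 2`, correction `-4/3`
      rw [degree_eq_card_sub_of_three_mul_sq ht h3, hL]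
      obtain ⟨r, hr⟩ := h3
      obtain ⟨k, hk⟩ : ∃ k : ℕ, m = 3 * k ^ 2 := ⟨r.natAbs, by
        have : ((3 * r.natAbs ^ 2 : ℕ) : ℤ) = (m : ℤ) := by
          rw [Nat.cast_mul, Nat.cast_pow, Int.natAbs_sq, Nat.cast_ofNat, hr]
        exact_mod_cast this.symm⟩
      have hk0 : 0 < k := Nat.pos_of_ne_zero fun h => by rw [h] at hk; simp at hk; omega
      subst hk
      rw [(conductor_of_three_mul_sq hk0).2]
      have hδ : (((1 - ZMod.χ₈ (((-3 : ℤ)) : ZMod 8)) * (1 - legendreSym 3 (-3)) : ℤ) : ℚ) = 2 := by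
        have : (1 - ZMod.χ₈ (((-3 : ℤ)) : ZMod 8)) * (1 - legendreSym 3 (-3)) = 2 := by decide +kernel
        rw [this]; norm_num
      rw [hδ, if_neg (by norm_num), if_pos rfl]
      ring
    · -- generic `t`: `d_K ∉ {-3, -4}`, no correction
      rw [degree_eq_card_of_not_sq ht h1 h3, hL,
        if_neg (fun h => h1 (isSquare_of_disc_conductor_eq hm h)),
        if_neg (fun h => h3 (exists_eq_three_mul_sq_of_disc_conductor_eq hm h))]
      ring

end KRY

end Literature.Geometry.Kaehler.ComplexTorus.QuaternionType
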